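import Mathlib.FieldTheory.Fixed
import Mathlib.Algebra.Ring.Action.Subobjects
import Mathlib.GroupTheory.GroupAction.SubMulAction
import Mathlib.GroupTheory.OrderOfElement
import Literature.AlgebraicGeometry.Frobenioids.Monoids
import Literature.IUT.HodgeTheaters.GlobalFrobenioids
import Literature.IUT.HodgeTheaters.GlobalFrobenioidsModel
import Literature.IUT.HodgeTheaters.GlobalFrobenioidsKummer
import HarnessLib

/-!
# [IUTchI] Example 5.1 (v) pp. 129–130 and (vii) p. 130 — complements: the ∞κ-coric structure
# determined by an ∞κ×-coric structure, the reconstruction of `†𝕄^⊛_mod ⊆ †𝕄^⊛_sol`,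
# `Prime(†ℱ^⊛_mod) ⥲ 𝕍_mod`, and the realified copies `†ℱ^⊛ℝ_j, †ℱ^⊛ℝ_⟨J⟩, †ℱ^⊛ℝ_J`

Mochizuki, *Inter-universal Teichmüller theory I*, §5, Example 5.1 "Global Frobenioids", kurims
manuscript (May 2020), (v) pp. 129–130, (vii) p. 130 ([IUTchI] Ex 5.1 (v)(vii) pp.129–130)
[claim: Mochizuki2012, status: disputed].  STATEMENTS-FIRST; nothing of the disputed content is
asserted.  This file COMPLETES the sibling `GlobalFrobenioidsKummer.lean` ((v), (vii)) — which is
not modified — with the displays of p. 129 and the realifications of p. 130 that it does not type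
(its module docstring deferred the realifications); the p. 126–128 complements are in
`GlobalFrobenioidsCyclotomes.lean`.

* (v) p. 129, first display: "any ∞κ×-coric structure `π₁^rat(†𝒟^⊛) ↷ †𝕄^⊛_∞κ×` on `†ℱ^⊛` determines
  an associated ∞κ-coric structure `π₁^rat(†𝒟^⊛) ↷ †𝕄^⊛_∞κ ⊆ †𝕄^⊛_∞κ×` by considering the subset of
  elements for which the restriction of the associated Kummer class to some [or, equivalently,
  every] subgroup of `π₁^rat(†𝒟^⊛)` that corresponds to an open subgroup of the decomposition group
  of some strictly critical point of `C_{F_mod}` is a torsion element": `CoricPair.restrict` (the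
  sub-pair on a stable subset, REAL), `CriticalRestrictionData` (the restriction maps, DATA),
  `CoricPair.torsionLocus` (REAL), `CoricPair.DeterminesInfκStructure` (the claim, a predicate).
* (v) p. 129, second display: "restricting Kummer classes … arising from `†𝕄^⊛_κ ⊆ †𝕄^⊛_∞κ` to
  subgroups of `π₁^{κ-sol}(†𝒟^⊛)` that correspond to decomposition groups of non-critical `F_mod`-,
  `F_sol`-valued points of `C_{F_mod}` yields a functorial algorithm for reconstructing the monoids
  with `π₁^{κ-sol}(†𝒟^⊛)`-action `†𝕄^⊛_mod, †𝕄^⊛_sol`, together with the field structure … from the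
  ∞κ-coric structure associated to `†ℱ^⊛`" [and its `π₁^rat`/`†𝕄^⊛` variant]: typed per the cell\'s
  policy for the reconstruction genre as an ALGORITHM object functorial in isomorphisms of its
  input (`ModSolReconstruction`, DATA) with the comparison to the data of (i) as a predicate
  (`ModSolReconstruction.RecoversModel`).
* (v) p. 129: "a purely category-theoretic construction, from the category `†ℱ^⊛`, of the natural
  bijection `Prime(†ℱ^⊛_mod) ⥲ 𝕍_mod`": `GlobalDivisorData.PrimeAt` (REAL: the tree\'s [FrdI] §0
  `Primes` of the divisor monoid at a [terminal] object) and `PrimeLabelling` (the bijection, DATA).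
  The completions `𝒪^⊿_𝔭̂` and the "MLF-Galois TM-pair of strictly Belyi type" (pp. 129–130) are
  [AbsTopIII] §3 objects (abc-iut-L4-t2; tree `AbsoluteAnabelian.MonoidKummerMaps`) — not re-typed.
* (vii) p. 130: "Write `†ℱ^⊛ℝ_j; †ℱ^⊛ℝ_⟨J⟩; †ℱ^⊛ℝ_J := ∏_{j∈J} †ℱ^⊛ℝ_j` for the respective realifications
  [or product of the underlying categories of the realifications] of the corresponding Frobenioids
  … [[FrdI], Proposition 5.3]": `FrobenioidRealification` (DATA: the realified category with its natural
  functor; the construction for model Frobenioids is the tree\'s `RealificationData.RlfModelOf`,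
  abc-iut-L1-t2), `LabelledCopy.realified`, `LabelledCopy.toRealified`, `realifiedProd`,
  `realifyProd` (over the sibling\'s `LabelledCopy` / `labelledProd`).
No printed statement is strengthened; no side is taken.
-/

namespace Literature.IUT.HodgeTheaters

open CategoryTheory Pointwise Literature.AlgebraicGeometry.Frobenioids

universe u' v u

section Coric

variable {Γ : Type u} [Group Γ] [TopologicalSpace Γ]

namespace CoricPair

/-- Equivariance of the partial multiplication, restated: `(g·x)·(g·y) = g·(x·y)`.
([IUTchI] Ex 5.1 (v) p.127) [claim: Mochizuki2012, status: disputed] -/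
theorem op_smul (P : CoricPair Γ) (g : Γ) (x y : P.carrier) (h : (x, y) ∈ P.pm.dom)
    (h' : (g • x, g • y) ∈ P.pm.dom) : P.pm.op ⟨(g • x, g • y), h'⟩ = g • P.pm.op ⟨(x, y), h⟩ :=
  (P.smul_op g ⟨(x, y), h⟩).symm

/-! ### (v) p. 129: the ∞κ-coric structure determined by an ∞κ×-coric structure -/

/-- The sub-pair of a pair `Γ ↷ P` on a `Γ`-stable subset `S` (a "sub-pseudo-monoid", pp. 124, 129):
the partial multiplication is restricted to the pairs of `S` whose product lies in `S`.
([IUTchI] Ex 5.1 (v) p.129) [claim: Mochizuki2012, status: disputed] -/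
def restrict (P : CoricPair Γ) (S : SubMulAction Γ P.carrier) : CoricPair Γ where
  carrier := S
  pm :=
    { dom := {p | ∃ h : ((p.1 : P.carrier), (p.2 : P.carrier)) ∈ P.pm.dom, P.pm.op ⟨_, h⟩ ∈ S}
      op := fun p => ⟨P.pm.op ⟨((p.1.1 : P.carrier), (p.1.2 : P.carrier)), p.2.1⟩, p.2.2⟩ }
  isOpen_stabilizer x := by
    rw [SubMulAction.stabilizer_of_subMul]
    exact P.isOpen_stabilizer (x : P.carrier)
  smul_dom g p := by
    have hdom : ((p.1 : P.carrier), (p.2 : P.carrier)) ∈ P.pm.dom ↔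
        (g • (p.1 : P.carrier), g • (p.2 : P.carrier)) ∈ P.pm.dom := P.smul_dom g _
    constructor
    · rintro ⟨h, hS⟩
      refine ⟨hdom.mp h, ?_⟩
      change P.pm.op ⟨(g • (p.1 : P.carrier), g • (p.2 : P.carrier)), hdom.mp h⟩ ∈ S
      rw [P.op_smul g _ _ h]
      exact S.smul_mem g hS
    · rintro ⟨h, hS⟩
      refine ⟨hdom.mpr h, ?_⟩
      change P.pm.op ⟨(g • (p.1 : P.carrier), g • (p.2 : P.carrier)), h⟩ ∈ S at hS
      rw [P.op_smul g _ _ (hdom.mpr h)] at hS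
      simpa using S.smul_mem g⁻¹ hS
  smul_op g p := Subtype.ext (P.smul_op g ⟨((p.1.1 : P.carrier), (p.1.2 : P.carrier)), p.2.1⟩)

end CoricPair

/-- DATA for the first display of p. 129: restriction of Kummer classes [`lim_H H¹(H, ·) → …`] to the
subgroups of `π₁^rat(†𝒟^⊛)` "that correspond to an open subgroup of the decomposition group of some
strictly critical point of `C_{F_mod}`" — an index set of such subgroups and, for each, the
restriction homomorphism to an abelian group [in which "torsion element [i.e., corresponds to a
root of unity]" is read].  TODO-merge:abc-iut-L2-t3 (Kummer classes), abc-iut-L4-t1 (decomposition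
groups of points). ([IUTchI] Ex 5.1 (v) p.129) [claim: Mochizuki2012, status: disputed] -/
structure CriticalRestrictionData (Γ : Type u) [Group Γ] (H : Type u) [CommGroup H] :
    Type (u + 1) where
  /-- the subgroups `D` [open subgroups of decomposition groups of strictly critical points] -/
  Idx : Type u
  subgroup : Idx → Subgroup Γ
  /-- the targets of the restriction maps -/
  target : Idx → Type u
  [grp : ∀ i, CommGroup (target i)]
  /-- restriction of Kummer classes to `D` -/
  res : ∀ i, H →* target i

attribute [instance] CriticalRestrictionData.grp

namespace CoricPair

variable {P : CoricPair Γ} {H : Type u} [CommGroup H]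
  (κ : P.carrier → H) (R : CriticalRestrictionData Γ H)

/-- "The subset of elements for which the restriction of the associated Kummer class to some
subgroup [of the family] is a torsion element [i.e., corresponds to a root of unity]" (p. 129), for
the Kummer map `κ : †𝕄^⊛_∞κ× → lim_H H¹(H, ·)` (p. 127; cf. `CoricPair.KummerRealization` in
`GlobalFrobenioidsCyclotomes.lean`) — REAL. ([IUTchI] Ex 5.1 (v) p.129)
[claim: Mochizuki2012, status: disputed] -/
def torsionLocus : Set P.carrier :=
  {x | ∃ i : R.Idx, IsOfFinOrder (R.res i (κ x))}

/-- **Ex. 5.1 (v), first display of p. 129**: for an ∞κ×-coric structure `Γ ↷ P` [with its Kummer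
map `κ` and restriction data `R`]: (a) "some [or, equivalently, every]" — torsion at one
subgroup of the family iff at all; (b) the torsion locus is `Γ`-stable; (c) the resulting sub-pair
`†𝕄^⊛_∞κ ⊆ †𝕄^⊛_∞κ×` IS an ∞κ-coric structure, i.e. is isomorphic to the model pair
`modelInfκ = (π₁^rat ↷ 𝕄^⊛_∞κ(†𝒟^⊚))`.  A predicate on the data, not asserted.
([IUTchI] Ex 5.1 (v) p.129) [claim: Mochizuki2012, status: disputed] -/
structure DeterminesInfκStructure (modelInfκ : CoricPair Γ) : Prop where
  /-- "some [or, equivalently, every]" -/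
  some_iff_every : ∀ x : P.carrier, (∃ i : R.Idx, IsOfFinOrder (R.res i (κ x))) ↔
    ∀ i : R.Idx, IsOfFinOrder (R.res i (κ x))
  /-- the torsion locus is stable under `π₁^rat(†𝒟^⊛)` -/
  smul_mem : ∀ (g : Γ) {x : P.carrier}, x ∈ torsionLocus κ R → g • x ∈ torsionLocus κ R
  /-- the sub-pair on the torsion locus is an ∞κ-coric structure -/
  isCoricStructure : IsCoricStructure Γ modelInfκ (P.restrict ⟨torsionLocus κ R, smul_mem⟩)

end CoricPair

end Coric

/-! ### (v) p. 129, second display: reconstructing `†𝕄^⊛_mod ⊆ †𝕄^⊛_sol` with the field structure -/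

/-- The second display of p. 129 as an ALGORITHM object (cell policy for the reconstruction genre):
to every pair `Γ ↷ P` [an ∞κ-coric structure] it assigns "the monoids with `π₁^{κ-sol}(†𝒟^⊛)`-action
`†𝕄^⊛_mod, †𝕄^⊛_sol`, together with the field structure … on the union of `†𝕄^⊛_mod, †𝕄^⊛_sol` with
`{0}`" — a field `K` [= `†𝕄^⊛_sol ∪ {0}`] with `Γ`-action by ring automorphisms and a subfield `Kmod`
[= `†𝕄^⊛_mod ∪ {0}`] — functorially in isomorphisms of pairs ("functorial algorithm").  [The recipe
"restricting Kummer classes … to decomposition groups of non-critical `F_mod`-, `F_sol`-valued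
points" is the CONTENT of the algorithm ([AbsTopIII] Thm 1.9), not its signature; the variant
`π₁^{κ-sol} ⇝ π₁^rat`, `†𝕄^⊛_mod, †𝕄^⊛_sol ⇝ †𝕄^⊛` (p. 129) has the same signature.]  DATA.
([IUTchI] Ex 5.1 (v) p.129) [claim: Mochizuki2012, status: disputed] -/
structure ModSolReconstruction (Γ : Type u) [Group Γ] [TopologicalSpace Γ] : Type (u + 1) where
  /-- `†𝕄^⊛_sol ∪ {0}` with its field structure -/
  K : CoricPair Γ → Type u
  [fld : ∀ P, Field (K P)]
  [act : ∀ P, MulSemiringAction Γ (K P)]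
  /-- `†𝕄^⊛_mod ∪ {0} ⊆ †𝕄^⊛_sol ∪ {0}` -/
  Kmod : ∀ P, Subfield (K P)
  /-- functoriality in isomorphisms of the input pair -/
  map : ∀ {P Q : CoricPair Γ}, CoricPair.Iso P Q → (K P ≃+* K Q)
  map_smul : ∀ {P Q : CoricPair Γ} (e : CoricPair.Iso P Q) (g : Γ) (x : K P),
    map e (g • x) = g • map e x
  map_mem : ∀ {P Q : CoricPair Γ} (e : CoricPair.Iso P Q) (x : K P), x ∈ Kmod P ↔ map e x ∈ Kmod Q

attribute [instance] ModSolReconstruction.fld ModSolReconstruction.act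

/-- COMPARISON form of the second display of p. 129, relative to the data `N` of (i): applied to [a
structure isomorphic to] the model pair, the algorithm returns a field `π₁^rat(†𝒟^⊛)`-isomorphic to
`𝕄̄^⊛_sol(†𝒟^⊚) := 𝕄^⊛_sol(†𝒟^⊚) ∪ {0} ⊆ 𝕄̄^⊛(†𝒟^⊚)` [the fixed field of `π₁^{rat/κ-sol}(†𝒟^⊛)` acting
through `π₁^rat ↠ π₁(†𝒟^⊛)`], carrying `Kmod` onto `𝕄̄^⊛_mod(†𝒟^⊚)` (`MbarMod`).  A predicate, not
asserted. ([IUTchI] Ex 5.1 (v) p.129) [claim: Mochizuki2012, status: disputed] -/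
@[mk_iff] structure ModSolReconstruction.RecoversModel (N : NFBridgeRecon.{u})
    (A : ModSolReconstruction N.piRat) (model : CoricPair N.piRat) : Prop where
  recovers : ∃ φ : A.K model ≃+*
      FixedPoints.subfield (N.ratKsolKer.map N.ratToAst.toMonoidHom) N.Fbar,
    (∀ (g : N.piRat) (x : A.K model), ((φ (g • x) : _) : N.Fbar) = N.ratToAst g • (φ x : N.Fbar)) ∧
    ∀ x : A.K model, x ∈ A.Kmod model ↔ ((φ x : _) : N.Fbar) ∈ N.MbarMod

/-! ### (v) p. 129: `Prime(†ℱ^⊛_mod) ⥲ 𝕍_mod` -/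

/-- `Prime(†ℱ^⊛_mod)`, "the set of primes [cf. [FrdI], §0] of the divisor monoid of `†ℱ^⊛_mod`"
(p. 129), REAL at the model level: the tree's [FrdI] §0 `Primes` of the divisor monoid
`Φ^⊛(†𝒟^⊚)(A₀)` at an object `A₀` of `†𝒟^⊛` [a terminal one for `†ℱ^⊛_mod`]. ([IUTchI] Ex 5.1 (v) p.129)
[claim: Mochizuki2012, status: disputed] -/
def GlobalDivisorData.PrimeAt {G : ProfiniteGrp.{u}} (Δ : GlobalDivisorData G) (A₀ : BaseCat G) :
    Type u :=
  Primes (Δ.Φ.obj (Opposite.op A₀))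

/-- "A purely category-theoretic construction, from the category `†ℱ^⊛`, of the natural bijection
`Prime(†ℱ^⊛_mod) ⥲ 𝕍_mod` — where … we think of `𝕍_mod` as the set of `π₁(†𝒟^⊛)`-orbits of `𝕍(†𝒟^⊚)`"
(p. 129): DATA recording the bijection at a terminal object `A₀` [the construction is the content of
(iv)–(v): `𝔭 ↦` the valuation whose decomposition group is `Π_{𝔭₀}`]; the label bijections of (vii)
(`LabelledCopy.label`) compose with it. ([IUTchI] Ex 5.1 (v) p.129)
[claim: Mochizuki2012, status: disputed] -/
structure PrimeLabelling {G : ProfiniteGrp.{u}} (Δ : GlobalDivisorData G) (Vmod : Type u') :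
    Type (max (u + 1) u') where
  /-- a terminal object of `†𝒟^⊛` [over which `†ℱ^⊛_mod` lives] -/
  A₀ : BaseCat G
  isTerminal : Limits.IsTerminal A₀
  /-- `Prime(†ℱ^⊛_mod) ⥲ 𝕍_mod` -/
  equiv : Δ.PrimeAt A₀ ≃ Vmod

/-! ### (vii) p. 130: the realified copies `†ℱ^⊛ℝ_j, †ℱ^⊛ℝ_⟨J⟩, †ℱ^⊛ℝ_J` -/

section Realified

/-- DATA: a *realification* of [a category carrying a Frobenioid structure] `C` — "[the underlying
category of] the realification" `C^ℝ` with the natural functor `C → C^ℝ` ([FrdI] Prop 5.3; the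
construction for model Frobenioids is the tree's `RealificationData.RlfModelOf` /
`RealificationData.toRlfModel`, TODO-merge:abc-iut-L1-t2). ([IUTchI] Ex 5.1 (vii) p.130)
[claim: Mochizuki2012, status: disputed] -/
structure FrobenioidRealification (C : Type u) [Category.{v} C] : Type (max u v + 1) where
  /-- the underlying category of `C^ℝ` -/
  cat : Type u
  [inst : Category.{v} cat]
  /-- the natural functor `C → C^ℝ` -/
  realify : C ⥤ cat

attribute [instance] FrobenioidRealification.inst

variable {J : Type v} {V : Type u} {Fmod : Type u} [Category.{v} Fmod] {Prime : Type u}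
  {L : Type u'}

/-- `†ℱ^⊛ℝ_j` (resp. `†ℱ^⊛ℝ_⟨J⟩`): the realification of the copy `†ℱ^⊛_j` (resp. `†ℱ^⊛_⟨J⟩`) of `†ℱ^⊛_mod`
(p. 130) — a copy of `†ℱ^⊛ℝ_mod` carrying the same labelling bijection `L ⥲ Prime(†ℱ^⊛_mod)`.
([IUTchI] Ex 5.1 (vii) p.130) [claim: Mochizuki2012, status: disputed] -/
def LabelledCopy.realified (c : LabelledCopy Fmod Prime L) (R : FrobenioidRealification Fmod) :
    LabelledCopy R.cat Prime L where
  cat := R.cat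
  copyEquiv := CategoryTheory.Equivalence.refl
  label := c.label

/-- The functor `†ℱ^⊛_j → †ℱ^⊛ℝ_j` induced by the realification functor through the copy
identification. ([IUTchI] Ex 5.1 (vii) p.130) [claim: Mochizuki2012, status: disputed] -/
def LabelledCopy.toRealified (c : LabelledCopy Fmod Prime L) (R : FrobenioidRealification Fmod) :
    c.cat ⥤ (c.realified R).cat :=
  c.copyEquiv.functor ⋙ R.realify

variable (J) in
/-- `†ℱ^⊛ℝ_J := ∏_{j ∈ J} †ℱ^⊛ℝ_j`, "[the] product of the underlying categories of the realifications"
(p. 130). ([IUTchI] Ex 5.1 (vii) p.130) [claim: Mochizuki2012, status: disputed] -/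
abbrev realifiedProd (F : ∀ j : J, LabelledCopy Fmod Prime (VCopy J V j)) (R : FrobenioidRealification Fmod) :
    Type (max v u) :=
  labelledProd J fun j => (F j).realified R

variable (J) in
/-- The componentwise realification functor `†ℱ^⊛_J → †ℱ^⊛ℝ_J`. ([IUTchI] Ex 5.1 (vii) p.130)
[claim: Mochizuki2012, status: disputed] -/
def realifyProd (F : ∀ j : J, LabelledCopy Fmod Prime (VCopy J V j)) (R : FrobenioidRealification Fmod) :
    labelledProd J F ⥤ realifiedProd J F R :=
  Functor.pi fun j => (F j).toRealified R

end Realified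

end Literature.IUT.HodgeTheaters
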